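import Summits.Ventures.Crystal3D.Theorems.StickyWulffConstantGenericWallFloorStackWalk
import HarnessLib

/-!
# The stack walk is REVERSIBLE: backward determinism of `walkStep` (crux `GenericWallFloor`, line
# `WallLedgerG`; first brick of the MERGE LOCALISATION of the stack ledger's residual `LOST`)

HONEST FRAMING. Part of the venture `Summits/Ventures/Crystal3D` (cell `crystal3d-full`), helper
`--supports` the crux `GenericWallFloor` (stmt-Ventures-19480) of `route-Ventures-StickyWulffConstant`,
registered line `WallLedgerG`, open stub `stub_twoSlabAdhesion` (general fillings).  `twoSlabAdhesion_stackLedger`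
(`…StackLedger`) books `LOSTᵢ = #topsᵢ − #distinct end ballsᵢ`.  Here: one step of the stack walk
(`…StackWalkDefs`: FULL / POP / PUSH / STOP) is INJECTIVE on sound well-formed states, so two walkers that ever
share a state `(ball, stack)` shared all earlier states.
* `StackWF z stack` — the structural invariant `StackSound` does not record: pushed levels carry the best-rising
  capper as direction, consecutive entry normals are DISTINCT (a cap through the top level's own normal POPs),
  the bottom normal is `0`; preserved (`walkStep_stackWF`, `walkRun_stackWF`).
* `dist_sq_hexagram`, `not_full_of_twin_nonpos` (LEMMA A: no ball is FULL in `G` and carries the non-positive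
  half-dozen of the twin `R_m G` — the two lower triangles form a hexagram with vertices `1/√3` apart),
  `cap_normal_eq` (LEMMA B: over a base frame `G` with direction `c`, an exact cap of `R_{m₁}G` with normal `m₁`
  carrying the `m₂`-non-negative `G`-half has `m₁ = m₂`).
* `walkStep_cases` (anatomy of a successful step) and **`walkStep_injective`**: FULL/POP and FULL/PUSH
  predecessors of one state contradict LEMMA A, POP/PUSH and two different POPs contradict LEMMA B.

WHAT THIS IS NOT: not the stub; non-revisiting of initial states, injectivity of `top ↦ end state` and the
pricing of coincident end BALLS are the next bricks; `ExactOnly` (C12-55) stays an input; F-C1 not moved.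
-/

noncomputable section

namespace Summit.Ventures.Crystal3D.Theorems

open Finset
open scoped InnerProductSpace

variable {X : Finset (EuclideanSpace ℝ (Fin 3))}

/-! ### The structural stack invariant -/

/-- The STRUCTURAL invariant of a walker's stack: the bottom entry has normal `0`; every other entry has the
best-rising capper of its frame (for its entry normal and the vertical `z`) as direction, and its entry normal
differs from the entry normal of the level below (a cap through the top level's own normal POPs). -/
def StackWF (z : EuclideanSpace ℝ (Fin 3)) : List WalkEntry → Prop
  | [] => True
  | [e] => e.nrm = 0
  | e :: e' :: rest => e.dir = bestCapper e.frame e.nrm z ∧ e.nrm ≠ e'.nrm ∧ StackWF z (e' :: rest)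

/-- Unfolding, one level. -/
@[simp] theorem stackWF_singleton (z : EuclideanSpace ℝ (Fin 3)) (e : WalkEntry) : StackWF z [e] ↔ e.nrm = 0 :=
  Iff.rfl

/-- Unfolding, two levels. -/
@[simp] theorem stackWF_cons_cons (z : EuclideanSpace ℝ (Fin 3)) (e e' : WalkEntry) (rest : List WalkEntry) :
    StackWF z (e :: e' :: rest) ↔
      (e.dir = bestCapper e.frame e.nrm z ∧ e.nrm ≠ e'.nrm ∧ StackWF z (e' :: rest)) := Iff.rfl

/-- The tail of a well-formed stack is well formed. -/
theorem StackWF.of_cons {z : EuclideanSpace ℝ (Fin 3)} {e : WalkEntry} {rest : List WalkEntry}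
    (h : StackWF z (e :: rest)) : StackWF z rest := by
  cases rest with
  | nil => trivial
  | cons e' rest' => exact h.2.2

/-- The walker's start stack `[⟨A, u, 0⟩]` is well formed. -/
theorem stackWF_start (z : EuclideanSpace ℝ (Fin 3)) (A : EuclideanSpace ℝ (Fin 3) ≃ₗᵢ[ℝ] EuclideanSpace ℝ (Fin 3))
    (u : EuclideanSpace ℝ (Fin 3)) : StackWF z [⟨A, u, 0⟩] := rfl

/-- **One step preserves `StackWF`.** -/
theorem walkStep_stackWF {z : EuclideanSpace ℝ (Fin 3)} {s s' : EuclideanSpace ℝ (Fin 3) × List WalkEntry}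
    (hW : StackWF z s.2) (h : walkStep X z s = some s') : StackWF z s'.2 := by
  classical
  obtain ⟨y, stk⟩ := s
  cases stk with
  | nil => simp at h
  | cons e rest =>
    simp only at hW
    by_cases hfull : ∀ w ∈ fccSlots, y + e.frame w ∈ X
    · rw [walkStep_of_full X z y e rest hfull] at h
      obtain rfl := Option.some.inj h
      exact hW
    by_cases hcap : ∃ n, IsOrientedCap X e.frame y e.dir n
    · rw [walkStep_of_cap X z y e rest hfull hcap] at h
      have hn : ‖Classical.choose hcap‖ = 1 := (Classical.choose_spec hcap).1
      obtain rfl := Option.some.inj h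
      cases rest with
      | nil =>
        have h0 : e.nrm = 0 := hW
        refine ⟨rfl, ?_, hW⟩
        show Classical.choose hcap ≠ e.nrm
        rw [h0]; intro hz0; rw [hz0, norm_zero] at hn; exact zero_ne_one hn
      | cons e' rest' =>
        by_cases hne : Classical.choose hcap = e.nrm
        · rw [capMove_cons_of_eq z y e e' rest' hne]; exact hW.2.2
        · rw [capMove_cons_of_ne z y e e' rest' hne]; exact ⟨rfl, hne, hW⟩
    · rw [walkStep_of_stop X z y e rest hfull hcap] at h; simp at h

/-- **The run preserves `StackWF`.** -/
theorem walkRun_stackWF {z : EuclideanSpace ℝ (Fin 3)} :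
    ∀ (k : ℕ) (s : EuclideanSpace ℝ (Fin 3) × List WalkEntry), StackWF z s.2 → StackWF z (walkRun X z k s).2
  | 0, s, hW => hW
  | k + 1, s, hW => by
    cases h : walkStep X z s with
    | none => rw [walkRun_succ_of_none X z k h]; exact hW
    | some s' => rw [walkRun_succ_of_some X z k h]; exact walkRun_stackWF k s' (walkStep_stackWF hW h)

/-! ### Geometry: the hexagram below a ball -/

/-- A positive slot of a menu normal other than a given vector. -/
theorem exists_pos_slot_ne (G : EuclideanSpace ℝ (Fin 3) ≃ₗᵢ[ℝ] EuclideanSpace ℝ (Fin 3))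
    {n : EuclideanSpace ℝ (Fin 3)} (hn : ‖n‖ = 1)
    (hmenu : ∀ w ∈ fccSlots, ⟪G w, n⟫_ℝ = 0 ∨ ⟪G w, n⟫_ℝ = Real.sqrt (2 / 3) ∨ ⟪G w, n⟫_ℝ = -Real.sqrt (2 / 3))
    (c : EuclideanSpace ℝ (Fin 3)) :
    ∃ p ∈ fccSlots, ⟪G p, n⟫_ℝ = Real.sqrt (2 / 3) ∧ p ≠ c := by
  obtain ⟨u₁, hu₁, u₂, hu₂, -, -, hn₁, hn₂, -, h12, -⟩ := exists_far_frame G hn hmenu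
  by_cases h : u₁ = c
  · refine ⟨u₂, hu₂, hn₂, fun h2 => ?_⟩
    rw [← h] at h2
    rw [h2, real_inner_self_eq_norm_sq, norm_eq_one_of_mem_fccSlots hu₁] at h12; norm_num at h12
  · exact ⟨u₁, hu₁, hn₁, h⟩

/-- **The hexagram.**  For a `{111}` menu normal `m` of `G`, an `m`-negative slot `q` and an `m`-positive slot
`p` at `120°` (`⟪q, p⟫ = −½`): the `G`-slot `x + Gq` and the lowered positive slot `x + Gp − 2√(2/3) m` (a slot
of the twin frame one layer below `x`) are at squared distance `1/3`. -/
theorem dist_sq_hexagram (G : EuclideanSpace ℝ (Fin 3) ≃ₗᵢ[ℝ] EuclideanSpace ℝ (Fin 3))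
    {m : EuclideanSpace ℝ (Fin 3)} (hm : ‖m‖ = 1) {q p : EuclideanSpace ℝ (Fin 3)} (hq : q ∈ fccSlots)
    (hp : p ∈ fccSlots) (hqm : ⟪G q, m⟫_ℝ = -Real.sqrt (2 / 3)) (hpm : ⟪G p, m⟫_ℝ = Real.sqrt (2 / 3))
    (hqp : ⟪q, p⟫_ℝ = -(1 / 2)) (x : EuclideanSpace ℝ (Fin 3)) :
    dist (x + G q) (x + G p - (2 * Real.sqrt (2 / 3)) • m) ^ 2 = 1 / 3 := by
  obtain ⟨h23, -⟩ := sqrt_twoThirds_facts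
  have e : (x + G q) - (x + G p - (2 * Real.sqrt (2 / 3)) • m) = G q - G p + (2 * Real.sqrt (2 / 3)) • m := by
    abel
  rw [dist_eq_norm, e, ← real_inner_self_eq_norm_sq]
  have hqq : ⟪G q, G q⟫_ℝ = 1 := by
    rw [real_inner_self_eq_norm_sq, LinearIsometryEquiv.norm_map, norm_eq_one_of_mem_fccSlots hq, one_pow]
  have hpp : ⟪G p, G p⟫_ℝ = 1 := by
    rw [real_inner_self_eq_norm_sq, LinearIsometryEquiv.norm_map, norm_eq_one_of_mem_fccSlots hp, one_pow]
  have hmm : ⟪m, m⟫_ℝ = 1 := by rw [real_inner_self_eq_norm_sq, hm, one_pow]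
  have hqp' : ⟪G q, G p⟫_ℝ = -(1 / 2) := by rw [LinearIsometryEquiv.inner_map_map]; exact hqp
  have hpq' : ⟪G p, G q⟫_ℝ = -(1 / 2) := by rw [real_inner_comm]; exact hqp'
  have hmq : ⟪m, G q⟫_ℝ = -Real.sqrt (2 / 3) := by rw [real_inner_comm]; exact hqm
  have hmp : ⟪m, G p⟫_ℝ = Real.sqrt (2 / 3) := by rw [real_inner_comm]; exact hpm
  simp only [inner_add_left, inner_add_right, inner_sub_left, inner_sub_right, real_inner_smul_left,
    real_inner_smul_right, hqq, hpp, hmm, hqp', hpq', hmq, hmp, hqm, hpm]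
  nlinarith [h23]

/-- Two balls of a `1`-separated configuration are not at squared distance `1/3`. -/
theorem false_of_dist_sq_eq_third (hX : ∀ p ∈ X, ∀ q ∈ X, p ≠ q → 1 ≤ dist p q)
    {a b : EuclideanSpace ℝ (Fin 3)} (ha : a ∈ X) (hb : b ∈ X) (h : dist a b ^ 2 = 1 / 3) : False := by
  have hne : a ≠ b := fun e => by rw [e, dist_self] at h; norm_num at h
  have h1 := hX a ha b hb hne
  nlinarith [dist_nonneg (x := a) (y := b)]

/-- **LEMMA A (no ball is full in a frame and capped in its twin).**  `m` a unit menu normal of `G`,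
`G′ = R_m G` its twin.  In a `1`-separated `X` no ball `x` has all twelve `G`-slots occupied and all
`m`-non-positive `G′`-slots occupied: the `m`-negative `G`-triangle and the `m`-negative `G′`-triangle below
`x` form a hexagram. -/
theorem not_full_of_twin_nonpos (hX : ∀ p ∈ X, ∀ q ∈ X, p ≠ q → 1 ≤ dist p q)
    (G G' : EuclideanSpace ℝ (Fin 3) ≃ₗᵢ[ℝ] EuclideanSpace ℝ (Fin 3)) {m : EuclideanSpace ℝ (Fin 3)} (hm : ‖m‖ = 1)
    (hmenu : ∀ w ∈ fccSlots, ⟪G w, m⟫_ℝ = 0 ∨ ⟪G w, m⟫_ℝ = Real.sqrt (2 / 3) ∨ ⟪G w, m⟫_ℝ = -Real.sqrt (2 / 3))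
    (hG' : ∀ x, G' x = G x - (2 * ⟪G x, m⟫_ℝ) • m) {x : EuclideanSpace ℝ (Fin 3)}
    (hfull : ∀ w ∈ fccSlots, x + G w ∈ X) (hocc : ∀ w ∈ fccSlots, ⟪G' w, m⟫_ℝ ≤ 0 → x + G' w ∈ X) : False := by
  have hrpos : 0 < Real.sqrt (2 / 3) := Real.sqrt_pos.2 (by norm_num)
  obtain ⟨u₁, hu₁, u₂, hu₂, -, -, hn₁, hn₂, -, h12, -⟩ := exists_far_frame G hm hmenu
  -- `a = x − G u₁` (full), `b = x + G′ u₂ = x + G u₂ − 2√(2/3) m` (twin, non-positive side)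
  have ha : x + G (-u₁) ∈ X := hfull _ (neg_mem_fccSlots hu₁)
  have hG'u₂ : G' u₂ = G u₂ - (2 * Real.sqrt (2 / 3)) • m := by rw [hG', hn₂]
  have hb : x + G u₂ - (2 * Real.sqrt (2 / 3)) • m ∈ X := by
    have h1 : ⟪G' u₂, m⟫_ℝ ≤ 0 := by rw [inner_twin_eq_neg G G' hm hG', hn₂]; linarith
    have := hocc u₂ hu₂ h1; rwa [hG'u₂, ← add_sub_assoc] at this
  refine false_of_dist_sq_eq_third hX ha hb (dist_sq_hexagram G hm (neg_mem_fccSlots hu₁) hu₂ ?_ hn₂ ?_ x)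
  · rw [map_neg, inner_neg_left, hn₁]
  · rw [inner_neg_left, h12]

/-- **LEMMA B (the cap normal is unique over a base frame).**  `G` a frame, `c` a slot, `m₁, m₂` unit menu
normals of `G` with `⟪G c, mᵢ⟫ = √(2/3)`, `G₁ = R_{m₁} G`.  If `x` carries the `m₁`-non-positive `G₁`-half
(an exact cap of `G₁` with normal `m₁`) and the `m₂`-non-negative `G`-half, then `m₁ = m₂`. -/
theorem cap_normal_eq (hX : ∀ p ∈ X, ∀ q ∈ X, p ≠ q → 1 ≤ dist p q)
    (G G₁ : EuclideanSpace ℝ (Fin 3) ≃ₗᵢ[ℝ] EuclideanSpace ℝ (Fin 3)) {m₁ m₂ : EuclideanSpace ℝ (Fin 3)}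
    (hm₁ : ‖m₁‖ = 1) (hm₂ : ‖m₂‖ = 1)
    (hmenu₁ : ∀ w ∈ fccSlots, ⟪G w, m₁⟫_ℝ = 0 ∨ ⟪G w, m₁⟫_ℝ = Real.sqrt (2 / 3) ∨ ⟪G w, m₁⟫_ℝ = -Real.sqrt (2 / 3))
    (hmenu₂ : ∀ w ∈ fccSlots, ⟪G w, m₂⟫_ℝ = 0 ∨ ⟪G w, m₂⟫_ℝ = Real.sqrt (2 / 3) ∨ ⟪G w, m₂⟫_ℝ = -Real.sqrt (2 / 3))
    {c : EuclideanSpace ℝ (Fin 3)} (hc : c ∈ fccSlots) (hc₁ : ⟪G c, m₁⟫_ℝ = Real.sqrt (2 / 3))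
    (hc₂ : ⟪G c, m₂⟫_ℝ = Real.sqrt (2 / 3)) (hG₁ : ∀ x, G₁ x = G x - (2 * ⟪G x, m₁⟫_ℝ) • m₁)
    {x : EuclideanSpace ℝ (Fin 3)} (hocc₁ : ∀ w ∈ fccSlots, ⟪G₁ w, m₁⟫_ℝ ≤ 0 → x + G₁ w ∈ X)
    (hocc₂ : ∀ w ∈ fccSlots, 0 ≤ ⟪G w, m₂⟫_ℝ → x + G w ∈ X) : m₁ = m₂ := by
  by_contra hne
  have hrpos : 0 < Real.sqrt (2 / 3) := Real.sqrt_pos.2 (by norm_num)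
  obtain ⟨h23, -⟩ := sqrt_twoThirds_facts
  have hGc : ‖G c‖ = 1 := by rw [LinearIsometryEquiv.norm_map, norm_eq_one_of_mem_fccSlots hc]
  rcases menu_normal_eq_or_eq_twin G hm₁ hm₂ hGc hmenu₁ hmenu₂ hc₁ hc₂ with h | h
  · exact hne h.symm
  -- `m₂ = 2√(2/3) G c − m₁`; the slot `−p₀` (`p₀ ≠ c` positive for `m₁`) is `m₁`-negative and `m₂`-in-plane
  obtain ⟨p₀, hp₀, hp₀m, hp₀c⟩ := exists_pos_slot_ne G hm₁ hmenu₁ c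
  have hcp₀ : ⟪c, p₀⟫_ℝ = 1 / 2 :=
    inner_eq_half_of_pos_pos G hm₁ hmenu₁ hc hp₀ (Ne.symm hp₀c) (by rw [hc₁]; exact hrpos) (by rw [hp₀m]; exact hrpos)
  have hq₂ : ⟪G (-p₀), m₂⟫_ℝ = 0 := by
    rw [h, map_neg, inner_neg_left, inner_sub_right, real_inner_smul_right,
      LinearIsometryEquiv.inner_map_map, real_inner_comm c p₀, hcp₀, hp₀m]
    ring
  -- occupied by the second half-dozen …
  have ha : x + G (-p₀) ∈ X := hocc₂ _ (neg_mem_fccSlots hp₀) (le_of_eq hq₂.symm)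
  -- … and within `1/√3` of the lowered positive slot `x + G c − 2√(2/3) m₁` of the first cap
  have hG₁c : G₁ c = G c - (2 * Real.sqrt (2 / 3)) • m₁ := by rw [hG₁, hc₁]
  have hb : x + G c - (2 * Real.sqrt (2 / 3)) • m₁ ∈ X := by
    have h1 : ⟪G₁ c, m₁⟫_ℝ ≤ 0 := by rw [inner_twin_eq_neg G G₁ hm₁ hG₁, hc₁]; linarith
    have := hocc₁ c hc h1; rwa [hG₁c, ← add_sub_assoc] at this
  refine false_of_dist_sq_eq_third hX ha hb (dist_sq_hexagram G hm₁ (neg_mem_fccSlots hp₀) hc ?_ hc₁ ?_ x)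
  · rw [map_neg, inner_neg_left, hp₀m]
  · rw [inner_neg_left, real_inner_comm, hcp₀]

/-! ### What a successful step looks like -/

/-- `pushMove`, unfolded. -/
theorem pushMove_eq (z y : EuclideanSpace ℝ (Fin 3)) (e : WalkEntry) (rest : List WalkEntry)
    (n : EuclideanSpace ℝ (Fin 3)) :
    pushMove z y e rest n = (y + twinFrame e.frame n (bestCapper (twinFrame e.frame n) n z),
      ⟨twinFrame e.frame n, bestCapper (twinFrame e.frame n) n z, n⟩ :: e :: rest) := rfl

/-- **Step anatomy.**  A successful step from `(y, e :: rest)` is FULL (all `e.frame`-slots occupied; straight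
on), or, for the chosen cap normal `n` of an oriented cap, a POP (`rest = e′ :: rest′`, `n = e.nrm`; step along
the previous direction) or a PUSH (`n ≠ e.nrm` unless `rest = []`; `pushMove`). -/
theorem walkStep_cases {z y : EuclideanSpace ℝ (Fin 3)} {e : WalkEntry} {rest : List WalkEntry}
    {s' : EuclideanSpace ℝ (Fin 3) × List WalkEntry} (h : walkStep X z (y, e :: rest) = some s') :
    ((∀ w ∈ fccSlots, y + e.frame w ∈ X) ∧ s' = (y + e.frame e.dir, e :: rest)) ∨
    ∃ n, IsOrientedCap X e.frame y e.dir n ∧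
      ((∃ e' rest', rest = e' :: rest' ∧ n = e.nrm ∧ s' = (y + e'.frame e'.dir, e' :: rest')) ∨
       ((∀ e' rest', rest = e' :: rest' → n ≠ e.nrm) ∧ s' = pushMove z y e rest n)) := by
  classical
  by_cases hfull : ∀ w ∈ fccSlots, y + e.frame w ∈ X
  · rw [walkStep_of_full X z y e rest hfull] at h
    exact Or.inl ⟨hfull, (Option.some.inj h).symm⟩
  by_cases hcap : ∃ n, IsOrientedCap X e.frame y e.dir n
  · rw [walkStep_of_cap X z y e rest hfull hcap] at h
    refine Or.inr ⟨Classical.choose hcap, Classical.choose_spec hcap, ?_⟩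
    have h' := (Option.some.inj h).symm
    cases rest with
    | nil => exact Or.inr ⟨fun e' rest' hh => (List.cons_ne_nil e' rest' hh.symm).elim, by rw [h', capMove_nil]⟩
    | cons e' rest' =>
      by_cases hne : Classical.choose hcap = e.nrm
      · exact Or.inl ⟨e', rest', rfl, hne, by rw [h', capMove_cons_of_eq z y e e' rest' hne]⟩
      · exact Or.inr ⟨fun _ _ _ => hne, by rw [h', capMove_cons_of_ne z y e e' rest' hne]⟩
  · rw [walkStep_of_stop X z y e rest hfull hcap] at h
    exact absurd h (by simp)

/-! ### Entries -/

/-- A linked entry with unit normal has the twin frame of the level below as its frame. -/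
theorem frame_eq_twinFrame_of_link {e e' : WalkEntry} (hn : ‖e.nrm‖ = 1) (hl : e.Link e') :
    e.frame = twinFrame e'.frame e.nrm :=
  LinearIsometryEquiv.ext fun x => by rw [hl.1 x, twinFrame_apply e'.frame hn x]

/-- Entries with equal frame, direction and normal are equal. -/
theorem WalkEntry.eq_of_parts {e₁ e₂ : WalkEntry} (hf : e₁.frame = e₂.frame) (hd : e₁.dir = e₂.dir)
    (hn : e₁.nrm = e₂.nrm) : e₁ = e₂ := by
  cases e₁; cases e₂; simp only at hf hd hn; subst hf; subst hd; subst hn; rfl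

/-! ### The pairwise exclusions -/

/-- A FULL predecessor and a POP predecessor of one state are incompatible (LEMMA A). -/
theorem false_of_full_of_pop (hX : ∀ p ∈ X, ∀ q ∈ X, p ≠ q → 1 ≤ dist p q)
    {z y : EuclideanSpace ℝ (Fin 3)} {ep e' : WalkEntry} (hSound : ep.Sound z) (hLink : ep.Link e')
    (hcap : IsOrientedCap X ep.frame y ep.dir ep.nrm) (hfull : ∀ w ∈ fccSlots, y + e'.frame w ∈ X) : False := by
  obtain ⟨-, hn, hmenu, -, -, -, -⟩ := hSound
  have hG : ∀ x, e'.frame x = ep.frame x - (2 * ⟪ep.frame x, ep.nrm⟫_ℝ) • ep.nrm :=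
    twin_symm e'.frame ep.frame hn hLink.1
  exact not_full_of_twin_nonpos hX e'.frame ep.frame hn (menu_reflect ep.frame e'.frame hn hmenu hG) hLink.1 hfull
    hcap.2.2.2.1

/-- A FULL predecessor and a PUSH predecessor of one state are incompatible (LEMMA A). -/
theorem false_of_full_of_push (hX : ∀ p ∈ X, ∀ q ∈ X, p ≠ q → 1 ≤ dist p q)
    {y : EuclideanSpace ℝ (Fin 3)} {F : EuclideanSpace ℝ (Fin 3) ≃ₗᵢ[ℝ] EuclideanSpace ℝ (Fin 3)}
    {v n : EuclideanSpace ℝ (Fin 3)} (hcap : IsOrientedCap X F y v n)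
    (hfull : ∀ w ∈ fccSlots, y + twinFrame F n w ∈ X) : False := by
  obtain ⟨hn, hmenu, -, hle, -⟩ := hcap
  have hG : ∀ x, twinFrame F n x = F x - (2 * ⟪F x, n⟫_ℝ) • n := fun x => twinFrame_apply F hn x
  have hF : ∀ x, F x = twinFrame F n x - (2 * ⟪twinFrame F n x, n⟫_ℝ) • n := twin_symm F (twinFrame F n) hn hG
  exact not_full_of_twin_nonpos hX (twinFrame F n) F hn (menu_reflect F (twinFrame F n) hn hmenu hG) hF hfull hle

/-- Two POP predecessors onto the same level popped through the same normal (LEMMA B). -/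
theorem nrm_eq_of_pop_of_pop (hX : ∀ p ∈ X, ∀ q ∈ X, p ≠ q → 1 ≤ dist p q)
    {z y : EuclideanSpace ℝ (Fin 3)} {e' ep₁ ep₂ : WalkEntry} (hdir : e'.dir ∈ fccSlots)
    (hS₁ : ep₁.Sound z) (hL₁ : ep₁.Link e') (hS₂ : ep₂.Sound z) (hL₂ : ep₂.Link e')
    (hcap₁ : IsOrientedCap X ep₁.frame y ep₁.dir ep₁.nrm) (hcap₂ : IsOrientedCap X ep₂.frame y ep₂.dir ep₂.nrm) :
    ep₁.nrm = ep₂.nrm := by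
  obtain ⟨-, hn₁, hmenu₁, -, -, -, -⟩ := hS₁
  obtain ⟨-, hn₂, hmenu₂, -, -, -, -⟩ := hS₂
  have hG₁ : ∀ x, e'.frame x = ep₁.frame x - (2 * ⟪ep₁.frame x, ep₁.nrm⟫_ℝ) • ep₁.nrm :=
    twin_symm e'.frame ep₁.frame hn₁ hL₁.1
  have hG₂ : ∀ x, e'.frame x = ep₂.frame x - (2 * ⟪ep₂.frame x, ep₂.nrm⟫_ℝ) • ep₂.nrm :=
    twin_symm e'.frame ep₂.frame hn₂ hL₂.1
  obtain ⟨-, -, -, hle₂, hgt₂⟩ := hcap₂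
  exact cap_normal_eq hX e'.frame ep₁.frame hn₁ hn₂ (menu_reflect ep₁.frame e'.frame hn₁ hmenu₁ hG₁)
    (menu_reflect ep₂.frame e'.frame hn₂ hmenu₂ hG₂) hdir hL₁.2 hL₂.2 hL₁.1 hcap₁.2.2.2.1
    (occupied_nonneg_of_cap ep₂.frame e'.frame hn₂ hle₂ hgt₂ hG₂)

/-- A POP predecessor and a PUSH predecessor of one state are incompatible (LEMMA B with `StackWF`). -/
theorem false_of_pop_of_push (hX : ∀ p ∈ X, ∀ q ∈ X, p ≠ q → 1 ≤ dist p q)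
    {z y : EuclideanSpace ℝ (Fin 3)} {F : EuclideanSpace ℝ (Fin 3) ≃ₗᵢ[ℝ] EuclideanSpace ℝ (Fin 3)}
    {v n : EuclideanSpace ℝ (Fin 3)} (hv : v ∈ fccSlots) (hcapψ : IsOrientedCap X F y v n)
    {ep : WalkEntry} (hS : ep.Sound z) (hL : ep.Link ⟨twinFrame F n, bestCapper (twinFrame F n) n z, n⟩)
    (hne : ep.nrm ≠ n) (hcap : IsOrientedCap X ep.frame y ep.dir ep.nrm) : False := by
  classical
  have hrpos : 0 < Real.sqrt (2 / 3) := Real.sqrt_pos.2 (by norm_num)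
  obtain ⟨-, hm, hmenu, -, -, -, -⟩ := hS
  obtain ⟨hn, hmenuF, hvn, hle, hgt⟩ := hcapψ
  set G := twinFrame F n with hGdef
  have hGF : ∀ x, G x = F x - (2 * ⟪F x, n⟫_ℝ) • n := fun x => twinFrame_apply F hn x
  have hmenuGn := menu_reflect F G hn hmenuF hGF
  have hoccn := occupied_nonneg_of_cap F G hn hle hgt hGF
  have hGm : ∀ x, G x = ep.frame x - (2 * ⟪ep.frame x, ep.nrm⟫_ℝ) • ep.nrm := twin_symm G ep.frame hm hL.1
  have hmenuGm := menu_reflect ep.frame G hm hmenu hGm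
  -- the common direction `c = bestCapper G n z` is `n`-positive
  have hflip : ∀ x, ⟪G x, n⟫_ℝ = -⟪F x, n⟫_ℝ := inner_twin_eq_neg F G hn hGF
  have hSne : (fccSlots.filter fun q => 0 < ⟪G q, n⟫_ℝ).Nonempty := by
    refine ⟨-v, Finset.mem_filter.2 ⟨neg_mem_fccSlots hv, ?_⟩⟩
    rw [map_neg, inner_neg_left, hflip, hvn, neg_neg]; exact hrpos
  obtain ⟨hcS, -⟩ := bestCapper_spec G n z hSne
  obtain ⟨hc, hcpos⟩ := Finset.mem_filter.1 hcS
  have hcn : ⟪G (bestCapper G n z), n⟫_ℝ = Real.sqrt (2 / 3) := by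
    rcases hmenuGn _ hc with h | h | h
    · rw [h] at hcpos; exact absurd hcpos (lt_irrefl 0)
    · exact h
    · rw [h] at hcpos; linarith
  exact hne (cap_normal_eq hX G ep.frame hm hn hmenuGm hmenuGn hc hL.2 hcn hL.1 hcap.2.2.2.1 hoccn)

/-! ### Backward determinism -/

/-- **The stack walk is injective on sound well-formed states.**  If two states with sound
(`StackSound`) and well-formed (`StackWF`) stacks step to the same state, they are equal. -/
theorem walkStep_injective (hX : ∀ p ∈ X, ∀ q ∈ X, p ≠ q → 1 ≤ dist p q) {z : EuclideanSpace ℝ (Fin 3)}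
    {s₁ s₂ s' : EuclideanSpace ℝ (Fin 3) × List WalkEntry}
    (hS₁ : StackSound z s₁.2) (hW₁ : StackWF z s₁.2) (hS₂ : StackSound z s₂.2) (hW₂ : StackWF z s₂.2)
    (h₁ : walkStep X z s₁ = some s') (h₂ : walkStep X z s₂ = some s') : s₁ = s₂ := by
  classical
  obtain ⟨y₁, stk₁⟩ := s₁
  obtain ⟨y₂, stk₂⟩ := s₂
  simp only at hS₁ hW₁ hS₂ hW₂
  cases stk₁ with
  | nil => simp at h₁
  | cons e₁ r₁ =>
  cases stk₂ with
  | nil => simp at h₂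
  | cons e₂ r₂ =>
  rcases walkStep_cases h₁ with ⟨hfull₁, hs₁⟩ | ⟨n₁, hcap₁, ⟨e₁', r₁', hr₁, hn₁, hs₁⟩ | ⟨hpush₁, hs₁⟩⟩ <;>
    rcases walkStep_cases h₂ with ⟨hfull₂, hs₂⟩ | ⟨n₂, hcap₂, ⟨e₂', r₂', hr₂, hn₂, hs₂⟩ | ⟨hpush₂, hs₂⟩⟩ <;>
    (try rw [pushMove_eq] at hs₁) <;> (try rw [pushMove_eq] at hs₂) <;>
    rw [hs₁] at hs₂ <;> injection hs₂ with hy hl <;> injection hl with he hr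
  · -- FULL / FULL
    subst he; subst hr
    have := add_right_cancel hy
    subst this; rfl
  · -- FULL / POP
    subst he; subst hr; subst hr₂; subst hn₂
    have hy' : y₁ = y₂ := add_right_cancel hy
    subst hy'; obtain ⟨hSo, hLi, -⟩ := hS₂; exact (false_of_full_of_pop hX hSo hLi hcap₂ hfull₁).elim
  · -- FULL / PUSH
    subst he; subst hr
    have hy' : y₁ = y₂ := add_right_cancel hy
    subst hy'; exact (false_of_full_of_push hX hcap₂ hfull₁).elim
  · -- POP / FULL
    subst he; subst hr; subst hr₁; subst hn₁
    have hy' : y₁ = y₂ := add_right_cancel hy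
    subst hy'; obtain ⟨hSo, hLi, -⟩ := hS₁; exact (false_of_full_of_pop hX hSo hLi hcap₁ hfull₂).elim
  · -- POP / POP
    subst he; subst hr; subst hr₁; subst hr₂; subst hn₁; subst hn₂
    have hy' : y₁ = y₂ := add_right_cancel hy
    subst hy'
    obtain ⟨hSo₁, hLi₁, hS'⟩ := hS₁
    obtain ⟨hSo₂, hLi₂, -⟩ := hS₂
    have hnn : e₁.nrm = e₂.nrm := nrm_eq_of_pop_of_pop hX hS'.top.1 hSo₁ hLi₁ hSo₂ hLi₂ hcap₁ hcap₂
    have hee : e₁ = e₂ := by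
      refine WalkEntry.eq_of_parts ?_ ?_ hnn
      · rw [frame_eq_twinFrame_of_link hSo₁.2.1 hLi₁, frame_eq_twinFrame_of_link hSo₂.2.1 hLi₂, hnn]
      · rw [hW₁.1, hW₂.1, frame_eq_twinFrame_of_link hSo₁.2.1 hLi₁, frame_eq_twinFrame_of_link hSo₂.2.1 hLi₂, hnn]
    subst hee; rfl
  · -- POP / PUSH
    subst he; subst hr; subst hr₁; subst hn₁
    have hy' : y₁ = y₂ := add_right_cancel hy
    subst hy'; obtain ⟨hSo, hLi, -⟩ := hS₁; exact (false_of_pop_of_push hX hS₂.top.1 hcap₂ hSo hLi hW₁.2.1 hcap₁).elim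
  · -- PUSH / FULL
    subst he; subst hr
    have hy' : y₁ = y₂ := add_right_cancel hy
    subst hy'; exact (false_of_full_of_push hX hcap₁ hfull₂).elim
  · -- PUSH / POP
    subst he; subst hr; subst hr₂; subst hn₂
    have hy' : y₁ = y₂ := add_right_cancel hy
    subst hy'; obtain ⟨hSo, hLi, -⟩ := hS₂; exact (false_of_pop_of_push hX hS₁.top.1 hcap₁ hSo hLi hW₂.2.1 hcap₂).elim
  · -- PUSH / PUSH
    injection hr with he' hr'
    subst he'; subst hr'
    have hnn : n₁ = n₂ := congrArg WalkEntry.nrm he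
    subst hnn
    have hy' : y₁ = y₂ := add_right_cancel hy
    subst hy'
    rfl

end Summit.Ventures.Crystal3D.Theorems

end
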